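import Summits.CriticalPhenomena.PercolationContinuityZ3.Theorems.PercNearOneGluingNoHeavyLowerTailSahiSymCubeSound
import Summits.CriticalPhenomena.PercolationContinuityZ3.Theorems.PercNearOneGluingNoHeavyLowerTailSahiCombSaturation
import Summits.CriticalPhenomena.PercolationContinuityZ3.Theorems.PercNearOneGluingNoHeavyLowerTailSahiC4CombBridge

/-!
# The symmetry-reduced coloured-antichain check `symCheckT` READ AT COMB LEVEL: with a comb-sound leaf test and (M⁺-k), `k ≤ n+1`, on the
# cube, `symCheckT m (n+2) test = true` gives (M⁺-(n+2)) on `Fin m`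

Support file (cell `prim-sahi`, seat `prim-sahi-typer` gen 33; `--supports stmt-CriticalPhenomena-4575`).  Pure proofs, no definitions, no
`sorry`, standard axioms.

Typer gen 29's `SahiSymCube.symCheckT m n test` visits ONE coloured antichain per orbit of `S_m × S_n` (canonical point set under the coordinate
permutations, restricted-growth colouring) and runs `test` on the co-generated family; its soundness `sahiPositive_of_symCheckT` is VALUE-level
(`E_n(μ_p) ≥ 0` for one `p` at a time, given `C_{≤ n−1}(μ_p)`).  Here the same bookkeeping is read COEFFICIENTWISE: comb positivity
(`SahiComb.CombPos`, all `p ∈ [0,1]^m` at once, in the tensor-Bernstein basis) is invariant under relabelling the colours (`sahiE_comp_perm`) and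
under the coordinate permutations (`SahiC4CombBridge.CombPos.comp_equiv` with `sahiE_coMem_imgE`), so

* `SahiComb.combPos_sahiE_of_surjColouring` — comb saturation with SURJECTIVE colourings (…`SahiCombSaturation` + Sahi's branching identity for a
  colour class left empty: the member is `univ`, `E_{n+2}(1, g) = n·E_{n+1}(g)`, comb-positive by (M⁺-(n+1)));
* `SahiSymCube.coMem_core_combPos` — the core bound of `…SahiSymCubeSound` with a comb-sound leaf test and a comb conclusion;
* **`SahiSymCube.combPos_of_symCheckT`** — `symCheckT m (n+2) test = true`, `test` comb-sound, (M⁺-k) on `Fin m` for `1 ≤ k ≤ n+1` ⟹ (M⁺-(n+2)) on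
  `Fin m`; `combPos_of_symCheck` (leaf `testN`, comb-sound by …`SahiCombLeafSound` — taken here as a hypothesis to keep the imports light).
Consumer: …`SahiCombCubeFiveAllOrders` (orders `5, …, 10` on five letters from the landed certificates, then every order). [this work]
-/

namespace Summit.CriticalPhenomena.PercolationContinuityZ3.Theorems

open Finset Function Equiv
open Literature.Combinatorics.Sahi2008
open Literature.Probability.Percolation.DecisionTree (ind ind_nonneg ind_of_mem ind_of_not_mem)
open SahiComb

/-! ## Surjective colourings suffice at comb level -/

namespace SahiComb

open scoped Classical

/-- **SURJECTIVE COLOURINGS SUFFICE (comb level).**  Given (M⁺-k) on the finite ground set `ι` for `1 ≤ k ≤ n+1`: if `p ↦ E_{n+2}(μ_p; 1_U)` is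
comb-positive for every family co-generated by an antichain `N ⊆ 2^ι` with a colouring `c` using ALL `n+2` colours on `N`, then (M⁺-(n+2)) holds on
`ι`.  (A colour class left empty co-generates the member `univ`; moving it to the head, `E_{n+2}(1, g) = n·E_{n+1}(g)` is comb-positive by (M⁺-(n+1)).)
[this work] -/
theorem combPos_sahiE_of_surjColouring {ι : Type} [Fintype ι] {n : ℕ}
    (hM : ∀ k, 1 ≤ k → k ≤ n + 1 → ∀ V : Fin k → Set (Set ι), (∀ j, IsUpperSet (V j)) →
      CombPos (fun _ : ι => k) (fun p => sahiE (bernoulliWeight p) k (fun j => ind (V j))))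
    (h : ∀ (N : Finset (Set ι)) (c : Set ι → Fin (n + 2)), IsAntichain (· ≤ ·) (N : Set (Set ι)) →
      (∀ i : Fin (n + 2), ∃ T ∈ N, c T = i) →
      CombPos (fun _ : ι => n + 2) (fun p => sahiE (bernoulliWeight p) (n + 2)
        (fun i => ind {S | ∀ T ∈ N, c T = i → ¬ S ⊆ T})))
    (U : Fin (n + 2) → Set (Set ι)) (hU : ∀ j, IsUpperSet (U j)) :
    CombPos (fun _ : ι => n + 2) (fun p => sahiE (bernoulliWeight p) (n + 2) (fun j => ind (U j))) := by
  refine combPos_sahiE_of_colouring hM (fun N c hN => ?_) U hU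
  by_cases hsurj : ∀ i : Fin (n + 2), ∃ T ∈ N, c T = i
  · exact h N c hN hsurj
  push Not at hsurj
  obtain ⟨i₀, hi₀⟩ := hsurj
  have hFup : ∀ i : Fin (n + 2), IsUpperSet {S : Set ι | ∀ T ∈ N, c T = i → ¬ S ⊆ T} :=
    fun i S S' hle hS T hT hcT hsub => hS T hT hcT (le_trans hle hsub)
  set F : Fin (n + 2) → Set ι → ℝ := fun i => ind {S : Set ι | ∀ T ∈ N, c T = i → ¬ S ⊆ T} with hF
  have hFi₀ : F i₀ = fun _ => 1 := by
    funext S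
    exact ind_of_mem fun T hT hcT => absurd hcT (hi₀ T hT)
  have key : ∀ p : ι → unitInterval, sahiE (bernoulliWeight p) (n + 2) F =
      n * sahiE (bernoulliWeight p) (n + 1) (fun k => F (swap 0 i₀ k.succ)) := by
    intro p
    rw [← sahiE_comp_perm (bernoulliWeight p) (n + 2) (swap 0 i₀) F, SahiAbsorbed.comp_swap_eq_cons F i₀,
      sahiE_succ_succ_of_head_eq_one (sum_bernoulliWeight p) _ (by rw [Fin.cons_zero, hFi₀]; rfl), Fin.tail_cons]
  rcases Nat.eq_zero_or_pos n with hn | hn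
  · subst hn
    exact (CombPos.zero _).congr fun p => by rw [key p]; simp
  · have htail := hM (n + 1) (by omega) le_rfl
      (fun k => {S : Set ι | ∀ T ∈ N, c T = swap 0 i₀ k.succ → ¬ S ⊆ T}) (fun k => hFup _)
    have hle : (fun _ : ι => n + 1) ≤ (fun _ : ι => n + 2) := fun _ => by simp
    exact ((htail.smul (Nat.cast_nonneg n)).mono hle).congr fun p => by rw [key p]

end SahiComb

/-! ## The core bound and the check, at comb level -/

namespace SahiSymCube

open OneCutCert CovTransferCert SahiC3Cube NCopyCert
open scoped Classical

/-- **THE CORE BOUND AT COMB LEVEL.**  If the check with a COMB-sound leaf test passes, then for every antichain `E` of points of the `m`-cube and every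
colouring `d` using all `n + 2` colours on `E`, `p ↦ E_{n+2}(μ_p; U_0, …, U_{n+1})` is comb-positive for the co-generated family (transport to the
canonical representative, relabel the colours, read the leaf — the bookkeeping of `coMem_core_nonneg` verbatim, with comb positivity carried through
`sahiE_comp_perm` and `SahiC4CombBridge.CombPos.comp_equiv` / `sahiE_coMem_imgE`). [this work] -/
theorem coMem_core_combPos {m n : ℕ} {test : (Fin (n + 2) → ℕ) → Bool}
    (htest : ∀ A : Fin (n + 2) → Set (Set (Fin m)), test (fun i => encA m (A i)) = true →
      CombPos (fun _ : Fin m => n + 2) (fun p => sahiE (bernoulliWeight p) (n + 2) (fun i => ind (A i))))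
    (h : symCheckT m (n + 2) test = true) {E : Finset ℕ} (hE : ∀ x ∈ E, x < 2 ^ m)
    (hanti : ∀ x ∈ E, ∀ y ∈ E, x ≠ y → x &&& y ≠ x) {d : ℕ → ℕ} (hdn : ∀ x ∈ E, d x < n + 2)
    (hsurj : ∀ i < n + 2, ∃ x ∈ E, d x = i) :
    CombPos (fun _ : Fin m => n + 2)
      (fun p => sahiE (bernoulliWeight p) (n + 2) (fun j : Fin (n + 2) => ind (coMem m E d (j : ℕ)))) := by
  obtain ⟨σ, hcanE, hcanC⟩ := exists_canonical m E d
  -- the canonical representative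
  set E' := imgE m σ E with hE'
  set d' : ℕ → ℕ := fun x => d (actP m σ⁻¹ x) with hd'
  set P := keyE E' with hP
  set l := P.map d' with hl
  have hE'lt : ∀ y ∈ E', y < 2 ^ m := imgE_lt σ E
  have hmem : E' ∈ canonE m := canonE_complete E' hE'lt (imgE_anti σ hE hanti) hcanE
  have hphase : colourPhase m (n + 2) test E' = true := by
    unfold symCheckT at h
    exact List.all_eq_true.1 h E' hmem
  -- the values of the transported colouring
  have hd'E : ∀ y ∈ E', ∃ x ∈ E, d' y = d x := by
    intro y hy
    obtain ⟨x, hx, rfl⟩ := mem_imgE.1 hy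
    refine ⟨x, hx, ?_⟩
    show d (actP m σ⁻¹ (actP m σ x)) = d x
    rw [actP_inv_actP σ (hE x hx)]
  set fol := folAux [] l with hfol
  have hmem_fol : ∀ a, a ∈ fol ↔ ∃ y ∈ E', d' y = a := by
    intro a
    rw [hfol, mem_folAux, hl, List.mem_map]
    simp only [List.not_mem_nil, false_or]
    constructor
    · rintro ⟨y, hy, rfl⟩; exact ⟨y, mem_keyE.1 hy, rfl⟩
    · rintro ⟨y, hy, rfl⟩; exact ⟨y, mem_keyE.2 hy, rfl⟩
  have hfol_lt : ∀ a ∈ fol, a < n + 2 := by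
    intro a ha
    obtain ⟨y, hy, rfl⟩ := (hmem_fol a).1 ha
    obtain ⟨x, hx, e⟩ := hd'E y hy
    rw [e]; exact hdn x hx
  have hfol_mem : ∀ i < n + 2, i ∈ fol := by
    intro i hi
    obtain ⟨x, hx, hdx⟩ := hsurj i hi
    refine (hmem_fol i).2 ⟨actP m σ x, mem_imgE.2 ⟨x, hx, rfl⟩, ?_⟩
    show d (actP m σ⁻¹ (actP m σ x)) = i
    rw [actP_inv_actP σ (hE x hx), hdx]
  have hfol_nd : fol.Nodup := folAux_nodup l List.nodup_nil
  have hfol_len : fol.length = n + 2 := by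
    rw [← List.toFinset_card_of_nodup hfol_nd]
    have hsub : fol.toFinset = range (n + 2) := by
      ext a
      rw [List.mem_toFinset, mem_range]
      exact ⟨hfol_lt a, hfol_mem a⟩
    rw [hsub, card_range]
  -- the relabelled colour list is a tested leaf
  obtain ⟨hrg, hnc⟩ := rgOK_rgsAux (n := n + 2) l [] List.nodup_nil (le_of_eq hfol_len)
  rw [List.length_nil] at hrg hnc
  rw [hfol_len] at hnc
  have hlen : (rgs l).length = E'.card := by
    show (rgsAux [] l).length = _
    rw [length_rgsAux, hl, List.length_map, hP, length_keyE]
  have hpass := colourPhase_complete hphase (rgs l) hlen hrg hnc hcanC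
  -- the relabelling `φ` and the relabelled colouring `c₁`
  set φ : ℕ → ℕ := fun a => fol.idxOf a with hφ
  set c₁ : ℕ → ℕ := fun x => φ (d' x) with hc₁
  have hrgs : rgs l = P.map c₁ := by
    show rgsAux [] l = _
    rw [rgsAux_eq_map, hl, List.map_map]; rfl
  rw [hrgs] at hpass
  have hA : (fun i : Fin (n + 2) => memN m (maskC m P (P.map c₁) i)) = fun i : Fin (n + 2) => encA m (coMem m E' c₁ (i : ℕ)) := by
    funext i; rw [encA_coMem]
  rw [hA] at hpass
  have hpos : CombPos (fun _ : Fin m => n + 2)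
      (fun p' => sahiE (bernoulliWeight p') (n + 2) (fun i : Fin (n + 2) => ind (coMem m E' c₁ (i : ℕ)))) :=
    htest (fun i : Fin (n + 2) => coMem m E' c₁ (i : ℕ)) hpass
  -- undo the relabelling: `φ` restricted to the colours is a permutation
  have hφlt : ∀ j < n + 2, φ j < n + 2 := by
    intro j hj
    rw [← hfol_len]
    exact List.idxOf_lt_length_of_mem (hfol_mem j hj)
  have hφinj : ∀ a ∈ fol, ∀ b ∈ fol, φ a = φ b → a = b := by
    intro a ha b hb hab
    have h1 := List.getElem_idxOf (List.idxOf_lt_length_of_mem ha)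
    have h2 := List.getElem_idxOf (List.idxOf_lt_length_of_mem hb)
    rw [← h1, ← h2]
    simp only [hφ] at hab
    simp only [hab]
  let f : Fin (n + 2) → Fin (n + 2) := fun j => ⟨φ j, hφlt j j.isLt⟩
  have hfinj : Function.Injective f := by
    intro j₁ j₂ hj
    exact Fin.ext (hφinj _ (hfol_mem _ j₁.isLt) _ (hfol_mem _ j₂.isLt) (congrArg Fin.val hj))
  let π : Equiv.Perm (Fin (n + 2)) := Equiv.ofBijective f (Finite.injective_iff_bijective.1 hfinj)
  have hrel : (fun j : Fin (n + 2) => ind (coMem m E' d' (j : ℕ))) =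
      fun j : Fin (n + 2) => ind (coMem m E' c₁ ((π j : Fin (n + 2)) : ℕ)) := by
    funext j
    have hπj : ((π j : Fin (n + 2)) : ℕ) = φ j := by simp [π, f]
    rw [hπj]
    congr 1
    ext S
    simp only [coMem, Set.mem_setOf_eq, hc₁]
    constructor
    · intro hS y hy hcy
      exact hS y hy (hφinj _ ((hmem_fol _).2 ⟨y, hy, rfl⟩) _ (hfol_mem _ j.isLt) hcy)
    · intro hS y hy hcy
      exact hS y hy (by rw [hcy])
  have hpos' : CombPos (fun _ : Fin m => n + 2)
      (fun p' => sahiE (bernoulliWeight p') (n + 2) (fun j : Fin (n + 2) => ind (coMem m E' d' (j : ℕ)))) := by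
    refine hpos.congr fun p' => ?_
    rw [hrel, sahiE_comp_perm (bernoulliWeight p') (n + 2) π (fun i : Fin (n + 2) => ind (coMem m E' c₁ (i : ℕ)))]
  -- undo the coordinate permutation: `F_E(p) = F_{E'}(p ∘ σ⁻¹)`
  have ht := SahiC4CombBridge.CombPos.comp_equiv σ hpos'
  exact ht.congr fun p => (sahiE_coMem_imgE σ p hE d (n + 2)).symm

/-- **(M⁺-(n+2)) ON `Fin m` FROM THE SYMMETRY-REDUCED CHECK** (any comb-sound leaf test), given (M⁺-k) on `Fin m` for `1 ≤ k ≤ n+1`: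
`symCheckT m (n+2) test = true` makes `p ↦ E_{n+2}(μ_p; 1_{U_0}, …, 1_{U_{n+1}})` comb-positive for EVERY family of increasing events of
`2^[m]`. [this work] -/
theorem combPos_of_symCheckT {m n : ℕ} {test : (Fin (n + 2) → ℕ) → Bool}
    (htest : ∀ A : Fin (n + 2) → Set (Set (Fin m)), test (fun i => encA m (A i)) = true →
      CombPos (fun _ : Fin m => n + 2) (fun p => sahiE (bernoulliWeight p) (n + 2) (fun i => ind (A i))))
    (h : symCheckT m (n + 2) test = true)
    (hM : ∀ k, 1 ≤ k → k ≤ n + 1 → ∀ V : Fin k → Set (Set (Fin m)), (∀ j, IsUpperSet (V j)) →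
      CombPos (fun _ : Fin m => k) (fun p => sahiE (bernoulliWeight p) k (fun j => ind (V j))))
    (U : Fin (n + 2) → Set (Set (Fin m))) (hU : ∀ j, IsUpperSet (U j)) :
    CombPos (fun _ : Fin m => n + 2) (fun p => sahiE (bernoulliWeight p) (n + 2) (fun j => ind (U j))) := by
  refine SahiComb.combPos_sahiE_of_surjColouring hM (fun N c hN hsurj => ?_) U hU
  have hE : ∀ x ∈ N.image encS, x < 2 ^ m := by
    intro x hx
    obtain ⟨T, -, rfl⟩ := mem_image.1 hx
    exact encS_lt T
  have hanti : ∀ x ∈ N.image encS, ∀ y ∈ N.image encS, x ≠ y → x &&& y ≠ x := by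
    intro x hx y hy hxy hland
    obtain ⟨T, hT, rfl⟩ := mem_image.1 hx
    obtain ⟨T', hT', rfl⟩ := mem_image.1 hy
    have hsub : T ⊆ T' := by
      have := (land_eq_self_iff_pt_subset (encS T') (encS_lt T)).1 hland
      rwa [pt_encS, pt_encS] at this
    exact hN (mem_coe.2 hT) (mem_coe.2 hT') (fun h => hxy (by rw [h])) hsub
  have hsurj' : ∀ i < n + 2, ∃ x ∈ N.image encS, (fun x => ((c (pt m x) : Fin (n + 2)) : ℕ)) x = i := by
    intro i hi
    obtain ⟨T, hT, hcT⟩ := hsurj ⟨i, hi⟩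
    exact ⟨encS T, mem_image.2 ⟨T, hT, rfl⟩, by simp only [pt_encS, hcT]⟩
  have key := coMem_core_combPos htest h hE hanti (fun x _ => (c (pt m x)).isLt) hsurj'
  have hfam : ∀ i : Fin (n + 2), {S : Set (Fin m) | ∀ T ∈ N, c T = i → ¬ S ⊆ T} =
      coMem m (N.image encS) (fun x => ((c (pt m x) : Fin (n + 2)) : ℕ)) (i : ℕ) := by
    intro i
    ext S
    simp only [coMem, Set.mem_setOf_eq]
    constructor
    · intro hS x hx hcx
      obtain ⟨T, hT, rfl⟩ := mem_image.1 hx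
      rw [pt_encS] at hcx ⊢
      exact hS T hT (Fin.ext hcx)
    · intro hS T hT hcT
      have := hS (encS T) (mem_image.2 ⟨T, hT, rfl⟩) (by rw [pt_encS, hcT])
      rwa [pt_encS] at this
  refine key.congr fun p => ?_
  congr 1
  funext i
  rw [hfam i]

/-- **(M⁺-(n+2)) on `Fin m` from `symCheck m (n+2) σb = true`** (leaf = `testN`), given a comb soundness theorem for `testN` (supplied by
…`SahiCombLeafSound`) and (M⁺-k) on `Fin m` for `k ≤ n+1`. [this work] -/
theorem combPos_of_symCheck {m n σb : ℕ} (h : symCheck m (n + 2) σb = true)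
    (htestN : ∀ A : Fin (n + 2) → Set (Set (Fin m)), testN m (n + 2) σb (fun i => encA m (A i)) = true →
      CombPos (fun _ : Fin m => n + 2) (fun p => sahiE (bernoulliWeight p) (n + 2) (fun i => ind (A i))))
    (hM : ∀ k, 1 ≤ k → k ≤ n + 1 → ∀ V : Fin k → Set (Set (Fin m)), (∀ j, IsUpperSet (V j)) →
      CombPos (fun _ : Fin m => k) (fun p => sahiE (bernoulliWeight p) k (fun j => ind (V j))))
    (U : Fin (n + 2) → Set (Set (Fin m))) (hU : ∀ j, IsUpperSet (U j)) :
    CombPos (fun _ : Fin m => n + 2) (fun p => sahiE (bernoulliWeight p) (n + 2) (fun j => ind (U j))) :=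
  combPos_of_symCheckT htestN h hM U hU

end SahiSymCube

end Summit.CriticalPhenomena.PercolationContinuityZ3.Theorems
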